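import Summits.QuantumAdvantage.QuantumAdvantage.Theorems.CharDialSegmentMovesH
import HarnessLib

/-!
# CharDial — segment moves, part I: the Young ladder's rank floor (juntas included), from `cubeRank_hard`

Support for `CharDial.WalkHardFJLinOdd` (stmt-QuantumAdvantage-32604), continuing part H.  Young data over a class assignment with `B`
classes have all their forms in the span of the `B` class indicators; when `B ≤ cubeRate n ≈ (n/log₂⁵ n)^{1/3}` the span hypothesis of this
lineage's `cubeRank_hard` holds and the data lose — WITH per-cut juntas `≤ log₂ n` and with no class-size hypothesis (`youngForms_floor_rank`).
Since classes of size `≥ m` number at most `n / m` (`classes_mul_le`), Young data over assignments all of whose classes have `> n / cubeRate n`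
elements lose (`youngForms_bigClasses`).  So the Young ladder has one axis, the class count: DECIDED for `B ≤ cubeRate n`, UNDECIDED at the
comb schedule `B = combB p n ≈ n/(8p log₂ n) > 2·cubeRate n` (part F), where the slice meets the HIGH side outside the rank dial (part G).
Part H's DigitDial floor is the effective junta-free version (`n ≥ 16`, `θ = 7/8`); asymptotically it is subsumed here.  Nothing about the
comb schedule is claimed.
-/

set_option autoImplicit false

namespace Summit.QuantumAdvantage.AdviceFreeQNC0.JLinPeel.SegMove

open Finset
open Summit.QuantumAdvantage.AdviceFreeQNC0

variable {n : ℕ} {p : ℕ}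

/-- **rank floor of the Young slice (juntas included), by name from `cubeRank_hard`.**  For every prime `p ≥ 5` there are `θ < 1` and `n₀`
such that for `n ≥ n₀`, every charge, every assignment with `B ≤ cubeRate n` classes and every junta ⊕ form datum over it whose juntas have
`≤ log₂ n` bits and whose every form is a scalar multiple of ONE class indicator, the presented strategy wins on `≤ θ·2ⁿ` inputs. -/
theorem youngForms_floor_rank (p : ℕ) [Fact p.Prime] (hp5 : 5 ≤ p) :
    ∃ θ : ℝ, θ < 1 ∧ ∃ n₀ : ℕ, ∀ n ≥ n₀, ∀ (c B : ℕ) (π : Fin n → Fin B), B ≤ cubeRate n →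
      ∀ D : JLinData p n, (∀ g, (D.J g).card ≤ Nat.log 2 n) →
        (∀ g, ∃ β : Fin B, ∃ l : ZMod p, D.a g = fun i => if π i = β then l else 0) →
        ((univ.filter fun u : Fin n → Bool => ringWinU c D.strat u = true).card : ℝ) ≤ θ * (2 : ℝ) ^ n := by
  obtain ⟨θ, hθ, n₀, hn₀⟩ := cubeRank_hard p hp5
  refine ⟨θ, hθ, n₀, fun n hn c B π hB D hJ hY => ?_⟩
  choose β l hβl using hY
  have hspan : ∀ g, ∃ lv : Fin (cubeRate n) → ZMod p,
      D.a g = fun i => ∑ j, lv j * (fun (j : Fin (cubeRate n)) (i : Fin n) => if (π i).val = j.val then (1 : ZMod p) else 0) j i := by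
    intro g
    refine ⟨fun j => if j.val = (β g).val then l g else 0, ?_⟩
    rw [hβl g]
    funext i
    rw [Finset.sum_eq_single ⟨(β g).val, lt_of_lt_of_le (β g).isLt hB⟩]
    · by_cases hπ : π i = β g
      · simp [hπ]
      · have hne : (π i).val ≠ (β g).val := fun h => hπ (Fin.ext h)
        simp [hπ, hne]
    · intro j _ hj
      have hne : j.val ≠ (β g).val := fun h => hj (Fin.ext h)
      simp [hne]
    · intro h
      exact absurd (Finset.mem_univ _) h
  exact hn₀ n hn c D hJ ⟨_, fun g _ => hspan g⟩

/-- classes of a total assignment partition the coordinates: their sizes add up to `n`. -/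
theorem sum_card_classes {B : ℕ} (π : Fin n → Fin B) : ∑ b : Fin B, (univ.filter fun i : Fin n => π i = b).card = n := by
  have h := Finset.card_eq_sum_card_fiberwise (s := (univ : Finset (Fin n))) (t := (univ : Finset (Fin B))) (f := π)
    fun i _ => Finset.mem_univ _
  simpa using h.symm

/-- large classes are few: if every class has `≥ m` elements then `B * m ≤ n`. -/
theorem classes_mul_le {B : ℕ} (π : Fin n → Fin B) {m : ℕ} (hm : ∀ b, m ≤ (univ.filter fun i : Fin n => π i = b).card) :
    B * m ≤ n := by
  calc B * m = ∑ _b : Fin B, m := by simp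
    _ ≤ ∑ b : Fin B, (univ.filter fun i : Fin n => π i = b).card := Finset.sum_le_sum fun b _ => hm b
    _ = n := sum_card_classes π

/-- ★ **the big-class end of the Young ladder is a theorem.**  For every prime `p ≥ 5`: `θ < 1`, `n₀` such that for `n ≥ n₀`, every charge,
every assignment all of whose classes have `≥ n / cubeRate n + 1` elements, and every Young datum over it with juntas `≤ log₂ n`, the presented
strategy wins on `≤ θ·2ⁿ` inputs (such assignments have `≤ cubeRate n` classes; `youngForms_floor_rank`). -/
theorem youngForms_bigClasses (p : ℕ) [Fact p.Prime] (hp5 : 5 ≤ p) :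
    ∃ θ : ℝ, θ < 1 ∧ ∃ n₀ : ℕ, ∀ n ≥ n₀, ∀ (c B : ℕ) (π : Fin n → Fin B),
      (∀ b, n / cubeRate n + 1 ≤ (univ.filter fun i : Fin n => π i = b).card) →
      ∀ D : JLinData p n, (∀ g, (D.J g).card ≤ Nat.log 2 n) →
        (∀ g, ∃ β : Fin B, ∃ l : ZMod p, D.a g = fun i => if π i = β then l else 0) →
        ((univ.filter fun u : Fin n → Bool => ringWinU c D.strat u = true).card : ℝ) ≤ θ * (2 : ℝ) ^ n := by
  obtain ⟨θ, hθ, n₀, hn₀⟩ := youngForms_floor_rank p hp5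
  obtain ⟨n₁, hn₁⟩ := polylog_rate_admissible 1 1
  refine ⟨θ, hθ, max n₀ (max n₁ 1), fun n hn c B π hm D hJ hY => hn₀ n (le_trans (le_max_left _ _) hn) c B π ?_ D hJ hY⟩
  have hn1 : 1 ≤ n := le_trans (le_trans (le_max_right _ _) (le_max_right _ _)) hn
  have hadm := hn₁ n (le_trans (le_trans (le_max_left _ _) (le_max_right _ _)) hn)
  set ℓ := Nat.log 2 n with hℓ
  set cR := cubeRate n with hcR
  have hℓ5 : 1 ^ 3 * ℓ ^ 5 ≤ n := by
    have h1 : ℓ ≤ (ℓ ^ 1 + 1) ^ 3 := by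
      rw [pow_one]; exact le_trans (Nat.le_succ ℓ) (Nat.le_self_pow (by norm_num) _)
    calc 1 ^ 3 * ℓ ^ 5 = ℓ * ℓ ^ 4 := by ring
      _ ≤ (ℓ ^ 1 + 1) ^ 3 * ℓ ^ 4 := Nat.mul_le_mul_right _ h1
      _ = 1 * (ℓ ^ 1 + 1) ^ 3 * ℓ ^ 4 := by ring
      _ ≤ n := hadm
  have hcR1 : 1 ≤ cR := le_cubeRate hn1 hℓ5
  have hBm : B * (n / cR + 1) ≤ n := classes_mul_le π hm
  by_contra hlt
  have hlt' : cR + 1 ≤ B := by omega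
  have h1 : n < n / cR * cR + cR := Nat.lt_div_mul_add (by omega)
  have h2 : (cR + 1) * (n / cR + 1) ≤ B * (n / cR + 1) := Nat.mul_le_mul_right _ hlt'
  nlinarith

end Summit.QuantumAdvantage.AdviceFreeQNC0.JLinPeel.SegMove
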